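import Summits.Ventures.HSemireg.ContractionSpanPartialFourier
import Mathlib.LinearAlgebra.Dual.Lemmas
import HarnessLib

/-!
# Venture HSemireg — THE RANK THEOREM: the polyvector contraction rank is invariant under the partial Fourier transform
# along one Künneth factor (class-level H-FM for `Φ = id × Φ_𝒫`), all dimensions, kernel proof (part 3 of 3)

HONEST FRAMING. Pure linear algebra in exterior algebras, written for the computation cell `pub-hsemireg` (seat p4) over
parts 1–2 (`ContractionSpanOpSpan.lean`, `ContractionSpanPartialFourier.lean`). Nothing here is a claim about any variety;
nothing here says that HC / HC_CM / HC_AV holds. Everything is PROVED; no `def`, no named fact.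

THE STEP SERVED. The census certificate (I2-β) «`18 ≤ r(𝓔) = 18`» of the g = 4 object `E₀ = Φ(I_{p×X ∪ X×q})` on
`A₀ = X × X̂` has its right side BY VALUE (th-2 `ht2rank4`, gs-eng-2): `ch(E₀) = −1 − e^{−c₁(𝒫)} + pt_X + pt_X̂`
(`step0/T4a/README-T4a.md` §2) is the image of the point-pair box `ch(I_p ⊠ I_q) = (1 − pt) ⊠ (1 − pt)` under Orlov's
`Φ_{X×X→X×X̂} = (id × Φ_𝒫) ∘ μ_*`, i.e. under a SHEAR `μ^*` (a linear automorphism of `H¹(X × X)` preserving `H^{0,1}`: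
p6 `rank_span_map_equiv`) followed by the Fourier–Mukai transform ALONG THE SECOND FACTOR — and the partial transform was
the piece the tree lacked (p6's `rank_span_fourier_eq` is the FULL dual `Λ V → Λ V^*`). Here:

1. `conj_mulLeft_ι`, `conj_contractLeft`, `symm_conj_mulLeft_ι`, `symm_conj_contractLeft`: the conjugates of the elementary
   operators under `F₂ = partialFourier b₂` — `(q₁,q₂) ∧ · ↦ (q₁,0) ∧ · + ι_{ev q₂ ∘ pr₂}`, `ι_θ ↦ ι_{θ∘inl∘pr₁} + (0, θ∘inr) ∧ ·`,
   and back (a form on `V₂^*` killing `Ann L₂` is `ev q₂` with `q₂ ∈ L₂`: Mathlib `Subspace.dualAnnihilator_dualAnnihilator_eq_map`).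
2. **`rank_span_partialFourier_eq`**: for submodules `L₁ ≤ V₁`, `L₂ ≤ V₂` (`V₂` finite-dimensional, basis `b₂`) and EVERY
   class `x ∈ Λ(V₁ × V₂)`:
   `rank span_{V₁×V₂} (L₁ × L₂) (Ann) x = rank span_{V₁×V₂^*} (L₁ × Ann L₂) (Ann) (partialFourier b₂ x)` — on the
   transformed side the wedging vectors of the second factor are `Ann L₂ = H^{0,1}(X̂₂)` and the contracting forms are
   `L₂ = H⁰(X̂₂, T)`: «`r(X₁ × X₂, ch G) = r(X₁ × X̂₂, ch Φ_{𝒫₂}(G))`» once `ch ∘ Φ_{𝒫₂} = F₂ ∘ ch` is supplied BY NAME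
   ([Mukai1981] Thm. 2.2 / the cohomological Fourier–Mukai transform; Künneth for the product).
CONSEQUENCE FOR THE CELL (by value, not in this file): `r(A₀, ch E₀) = r(X × X, ch(I_p ⊠ I_q)) = 18` by seat p4's
`contractionRank_pointPairBox_two`, modulo the by-value identification `ch(E₀) = F₂(μ^* ch(I_p ⊠ I_q))` read in `Λ H¹(A₀)` and
the Künneth splitting — the right side of (I2-β) as a theorem of the class SHAPE instead of an engine number. Labels F-1 / F-3
of the g = 4 rows are UNCHANGED by this file. References: [BourbakiAlgebre1a3] Ch. II §7 no. 5, Ch. III §11 no. 9–11;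
[Mukai1981] Thm. 2.2; [Orlov2002DerivedAbelian] Assertion 2.8; [BuchweitzFlenner2008HH] Prop. 6.4.4.
-/

noncomputable section

open CliffordAlgebra (contractLeft)
open ExteriorAlgebra (ι)
open scoped TensorProduct

namespace Summit.Ventures.HSemireg

namespace ContractionSpan

/-! ### 1. Conjugation of the elementary operators and THE RANK THEOREM -/

section Main

universe u

variable {K : Type u} [Field K] {V₁ V₂ : Type u} [AddCommGroup V₁] [Module K V₁] [AddCommGroup V₂] [Module K V₂]
variable {n : ℕ} (b₂ : Module.Basis (Fin n) K V₂)

/-- `(q₁, q₂) = (q₁, 0) + (0, q₂)` under `ι`. [cite: BourbakiAlgebre1a3, Ch. III §7 no. 7] -/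
theorem ι_prod_eq_add {W : Type u} [AddCommGroup W] [Module K W] (q₁ : V₁) (w : W) :
    ι K ((q₁, w) : V₁ × W) = ι K ((q₁, 0) : V₁ × W) + ι K ((0, w) : V₁ × W) := by
  rw [← map_add, Prod.mk_add_mk, add_zero, zero_add]

/-- A linear form on `V₁ × W` is the sum of its two restrictions. [cite: BourbakiAlgebre1a3, Ch. II §1 no. 6] -/
theorem dual_prod_eq_add {W : Type u} [AddCommGroup W] [Module K W] (θ : Module.Dual K (V₁ × W)) :
    θ = (θ ∘ₗ LinearMap.inl K V₁ W) ∘ₗ LinearMap.fst K V₁ W + (θ ∘ₗ LinearMap.inr K V₁ W) ∘ₗ LinearMap.snd K V₁ W := by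
  refine LinearMap.ext fun v => ?_
  obtain ⟨v₁, w⟩ := v
  simp only [LinearMap.add_apply, LinearMap.comp_apply, LinearMap.fst_apply, LinearMap.snd_apply, LinearMap.inl_apply,
    LinearMap.inr_apply, ← map_add, Prod.mk_add_mk, add_zero, zero_add]

/-- **Conjugate of `(q₁, q₂) ∧ ·`**: `F₂ ∘ ((q₁,q₂) ∧ ·) ∘ F₂⁻¹ = (q₁, 0) ∧ · + ι_{ev q₂ ∘ pr₂}`.
[cite: BourbakiAlgebre1a3, Ch. III §11 no. 11 Prop. 12] -/
theorem conj_mulLeft_ι (q₁ : V₁) (q₂ : V₂) :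
    (partialFourier b₂).conj (LinearMap.mulLeft K (ι K ((q₁, q₂) : V₁ × V₂))) =
      LinearMap.mulLeft K (ι K ((q₁, 0) : V₁ × Module.Dual K V₂)) +
        contractLeft ((Module.Dual.eval K V₂ q₂) ∘ₗ LinearMap.snd K V₁ (Module.Dual K V₂)) := by
  refine LinearMap.ext fun y => ?_
  obtain ⟨x, rfl⟩ := (partialFourier b₂).surjective y
  rw [LinearEquiv.conj_apply_apply, LinearEquiv.symm_apply_apply, LinearMap.add_apply, LinearMap.mulLeft_apply,
    LinearMap.mulLeft_apply, ι_prod_eq_add, add_mul, map_add, partialFourier_ι_inl_mul, partialFourier_ι_inr_mul]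

/-- **Conjugate of `ι_θ`**: `F₂ ∘ ι_θ ∘ F₂⁻¹ = ι_{θ∘inl∘pr₁} + (0, θ∘inr) ∧ ·`. [cite: BourbakiAlgebre1a3, Ch. III §11 no. 11 Prop. 12] -/
theorem conj_contractLeft (θ : Module.Dual K (V₁ × V₂)) :
    (partialFourier b₂).conj (contractLeft θ) =
      contractLeft ((θ ∘ₗ LinearMap.inl K V₁ V₂) ∘ₗ LinearMap.fst K V₁ (Module.Dual K V₂)) +
        LinearMap.mulLeft K (ι K ((0, θ ∘ₗ LinearMap.inr K V₁ V₂) : V₁ × Module.Dual K V₂)) := by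
  refine LinearMap.ext fun y => ?_
  obtain ⟨x, rfl⟩ := (partialFourier b₂).surjective y
  rw [LinearEquiv.conj_apply_apply, LinearEquiv.symm_apply_apply, LinearMap.add_apply, LinearMap.mulLeft_apply]
  conv_lhs => rw [dual_prod_eq_add θ]
  rw [map_add, LinearMap.add_apply, map_add, partialFourier_contractLeft_fst, partialFourier_contractLeft_snd]

/-- **Inverse conjugate of `(q₁, φ) ∧ ·`**: `F₂⁻¹ ∘ ((q₁,φ) ∧ ·) ∘ F₂ = (q₁, 0) ∧ · + ι_{φ ∘ pr₂}`.
[cite: BourbakiAlgebre1a3, Ch. III §11 no. 11 Prop. 12] -/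
theorem symm_conj_mulLeft_ι (q₁ : V₁) (φ : Module.Dual K V₂) :
    (partialFourier b₂).symm.conj (LinearMap.mulLeft K (ι K ((q₁, φ) : V₁ × Module.Dual K V₂))) =
      LinearMap.mulLeft K (ι K ((q₁, 0) : V₁ × V₂)) + contractLeft (φ ∘ₗ LinearMap.snd K V₁ V₂) := by
  refine LinearMap.ext fun x => ?_
  apply (partialFourier b₂).injective
  rw [LinearEquiv.conj_apply_apply, LinearEquiv.symm_symm, LinearEquiv.apply_symm_apply, LinearMap.add_apply, map_add,
    LinearMap.mulLeft_apply, LinearMap.mulLeft_apply, partialFourier_ι_inl_mul, partialFourier_contractLeft_snd, ← add_mul,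
    ← ι_prod_eq_add]

/-- **Inverse conjugate of `ι_{θ'}`** when `θ' ∘ inr = ev q₂`: `F₂⁻¹ ∘ ι_{θ'} ∘ F₂ = ι_{θ'∘inl∘pr₁} + (0, q₂) ∧ ·`.
[cite: BourbakiAlgebre1a3, Ch. III §11 no. 11 Prop. 12] -/
theorem symm_conj_contractLeft (θ' : Module.Dual K (V₁ × Module.Dual K V₂)) {q₂ : V₂}
    (h : θ' ∘ₗ LinearMap.inr K V₁ (Module.Dual K V₂) = Module.Dual.eval K V₂ q₂) :
    (partialFourier b₂).symm.conj (contractLeft θ') =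
      contractLeft ((θ' ∘ₗ LinearMap.inl K V₁ (Module.Dual K V₂)) ∘ₗ LinearMap.fst K V₁ V₂) +
        LinearMap.mulLeft K (ι K ((0, q₂) : V₁ × V₂)) := by
  refine LinearMap.ext fun x => ?_
  apply (partialFourier b₂).injective
  rw [LinearEquiv.conj_apply_apply, LinearEquiv.symm_symm, LinearEquiv.apply_symm_apply, LinearMap.add_apply, map_add,
    LinearMap.mulLeft_apply, partialFourier_contractLeft_fst, partialFourier_ι_inr_mul, ← h, ← LinearMap.add_apply,
    ← map_add, ← dual_prod_eq_add θ']

variable (L₁ : Submodule K V₁) (L₂ : Submodule K V₂)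

/-- The elementary operators of `(L₁ × L₂, Ann)` conjugate INTO the span of those of `(L₁ × Ann L₂, Ann)`.
[cite: BourbakiAlgebre1a3, Ch. III §11 no. 11 Prop. 12] -/
theorem conj_elemOps_mem (T : Module.End K (ExteriorAlgebra K (V₁ × V₂)))
    (hT : T ∈ elemOps (L₁.prod L₂ : Set (V₁ × V₂)) {θ | ∀ q ∈ L₁.prod L₂, θ q = 0}) :
    (partialFourier b₂).conj T ∈ Submodule.span K
      (elemOps (L₁.prod L₂.dualAnnihilator : Set (V₁ × Module.Dual K V₂))
        {θ' | ∀ q' ∈ L₁.prod L₂.dualAnnihilator, θ' q' = 0}) := by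
  rcases hT with ⟨q, hq, rfl⟩ | ⟨θ, hθ, rfl⟩
  · obtain ⟨q₁, q₂⟩ := q
    rw [SetLike.mem_coe, Submodule.mem_prod] at hq
    rw [conj_mulLeft_ι]
    refine Submodule.add_mem _ (Submodule.subset_span (Or.inl ⟨(q₁, 0), ?_, rfl⟩))
      (Submodule.subset_span (Or.inr ⟨_, fun q' hq' => ?_, rfl⟩))
    · exact Submodule.mem_prod.2 ⟨hq.1, Submodule.zero_mem _⟩
    · rw [LinearMap.comp_apply, LinearMap.snd_apply, Module.Dual.eval_apply]
      exact (Submodule.mem_dualAnnihilator _).1 (Submodule.mem_prod.1 hq').2 q₂ hq.2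
  · rw [conj_contractLeft]
    refine Submodule.add_mem _ (Submodule.subset_span (Or.inr ⟨_, fun q' hq' => ?_, rfl⟩))
      (Submodule.subset_span (Or.inl ⟨(0, θ ∘ₗ LinearMap.inr K V₁ V₂), ?_, rfl⟩))
    · rw [LinearMap.comp_apply, LinearMap.comp_apply, LinearMap.fst_apply, LinearMap.inl_apply]
      exact hθ (q'.1, 0) (Submodule.mem_prod.2 ⟨(Submodule.mem_prod.1 hq').1, Submodule.zero_mem _⟩)
    · refine Submodule.mem_prod.2 ⟨Submodule.zero_mem _, (Submodule.mem_dualAnnihilator _).2 fun w hw => ?_⟩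
      rw [LinearMap.comp_apply, LinearMap.inr_apply]
      exact hθ (0, w) (Submodule.mem_prod.2 ⟨Submodule.zero_mem _, hw⟩)

/-- The elementary operators of `(L₁ × Ann L₂, Ann)` conjugate back INTO the span of those of `(L₁ × L₂, Ann)`
(`V₂` finite-dimensional: a form on `V₂^*` killing `Ann L₂` is evaluation at a vector of `L₂`).
[cite: BourbakiAlgebre1a3, Ch. II §7 no. 5 Thm. 7] [cite: BourbakiAlgebre1a3, Ch. III §11 no. 11 Prop. 12] -/
theorem symm_conj_elemOps_mem [FiniteDimensional K V₂] (T' : Module.End K (ExteriorAlgebra K (V₁ × Module.Dual K V₂)))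
    (hT' : T' ∈ elemOps (L₁.prod L₂.dualAnnihilator : Set (V₁ × Module.Dual K V₂))
      {θ' | ∀ q' ∈ L₁.prod L₂.dualAnnihilator, θ' q' = 0}) :
    (partialFourier b₂).symm.conj T' ∈ Submodule.span K
      (elemOps (L₁.prod L₂ : Set (V₁ × V₂)) {θ | ∀ q ∈ L₁.prod L₂, θ q = 0}) := by
  rcases hT' with ⟨q', hq', rfl⟩ | ⟨θ', hθ', rfl⟩
  · obtain ⟨q₁, φ⟩ := q'
    rw [SetLike.mem_coe, Submodule.mem_prod] at hq'
    rw [symm_conj_mulLeft_ι]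
    refine Submodule.add_mem _ (Submodule.subset_span (Or.inl ⟨(q₁, 0), ?_, rfl⟩))
      (Submodule.subset_span (Or.inr ⟨_, fun q hq => ?_, rfl⟩))
    · exact Submodule.mem_prod.2 ⟨hq'.1, Submodule.zero_mem _⟩
    · rw [LinearMap.comp_apply, LinearMap.snd_apply]
      exact (Submodule.mem_dualAnnihilator _).1 hq'.2 q.2 (Submodule.mem_prod.1 hq).2
  · -- the `V₂^*`-component of `θ'` kills `Ann L₂`, hence is `ev q₂` for some `q₂ ∈ L₂`
    have hmem : θ' ∘ₗ LinearMap.inr K V₁ (Module.Dual K V₂) ∈ L₂.dualAnnihilator.dualAnnihilator := by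
      refine (Submodule.mem_dualAnnihilator _).2 fun φ hφ => ?_
      rw [LinearMap.comp_apply, LinearMap.inr_apply]
      exact hθ' (0, φ) (Submodule.mem_prod.2 ⟨Submodule.zero_mem _, hφ⟩)
    rw [Subspace.dualAnnihilator_dualAnnihilator_eq_map, Submodule.mem_map] at hmem
    obtain ⟨q₂, hq₂, hq₂'⟩ := hmem
    rw [symm_conj_contractLeft b₂ θ' hq₂'.symm]
    refine Submodule.add_mem _ (Submodule.subset_span (Or.inr ⟨_, fun q hq => ?_, rfl⟩))
      (Submodule.subset_span (Or.inl ⟨(0, q₂), Submodule.mem_prod.2 ⟨Submodule.zero_mem _, hq₂⟩, rfl⟩))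
    rw [LinearMap.comp_apply, LinearMap.comp_apply, LinearMap.fst_apply, LinearMap.inl_apply]
    exact hθ' (q.1, 0) (Submodule.mem_prod.2 ⟨(Submodule.mem_prod.1 hq).1, Submodule.zero_mem _⟩)

/-- **THE RANK THEOREM (class-level H-FM along one Künneth factor).** For `L₁ ≤ V₁`, `L₂ ≤ V₂` (`V₂` finite-dimensional
with a basis `b₂`) and EVERY class `x ∈ Λ(V₁ × V₂)`: the polyvector contraction rank of `x` for the datum
«vectors `L₁ × L₂` by wedge, their annihilator by interior product» equals that of its partial Fourier transform
`partialFourier b₂ x ∈ Λ(V₁ × V₂^*)` for the datum «`L₁ × Ann L₂` by wedge, its annihilator by interior product» —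
«`r(X₁ × X₂, ch G) = r(X₁ × X̂₂, ch Φ_{𝒫₂}(G))`» once `ch ∘ Φ_{𝒫₂} = F₂ ∘ ch` is supplied BY NAME.
[cite: BourbakiAlgebre1a3, Ch. III §11 no. 11 Prop. 12] [cite: Mukai1981, Thm. 2.2] [cite: BuchweitzFlenner2008HH, Prop. 6.4.4] -/
theorem rank_span_partialFourier_eq [FiniteDimensional K V₂] (x : ExteriorAlgebra K (V₁ × V₂)) :
    Module.rank K (span (L₁.prod L₂ : Set (V₁ × V₂)) {θ | ∀ q ∈ L₁.prod L₂, θ q = 0} x) =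
      Module.rank K (span (L₁.prod L₂.dualAnnihilator : Set (V₁ × Module.Dual K V₂))
        {θ' | ∀ q' ∈ L₁.prod L₂.dualAnnihilator, θ' q' = 0} (partialFourier b₂ x)) := by
  have hΘL : ∀ θ ∈ {θ : Module.Dual K (V₁ × V₂) | ∀ q ∈ L₁.prod L₂, θ q = 0},
      ∀ q ∈ (L₁.prod L₂ : Set (V₁ × V₂)), θ q = 0 := fun θ hθ q hq => hθ q hq
  have hΘL' : ∀ θ' ∈ {θ' : Module.Dual K (V₁ × Module.Dual K V₂) | ∀ q' ∈ L₁.prod L₂.dualAnnihilator, θ' q' = 0},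
      ∀ q' ∈ (L₁.prod L₂.dualAnnihilator : Set (V₁ × Module.Dual K V₂)), θ' q' = 0 := fun θ hθ q hq => hθ q hq
  rw [span_eq_opSpan hΘL, span_eq_opSpan hΘL']
  exact rank_opSpan_eq_of_conj (partialFourier b₂) (conj_elemOps_mem b₂ L₁ L₂) (symm_conj_elemOps_mem b₂ L₁ L₂) x

end Main

end ContractionSpan

end Summit.Ventures.HSemireg

end
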